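import Mathlib.RingTheory.PowerSeries.PiTopology
import Mathlib.NumberTheory.Padics.ProperSpace
import Mathlib.Algebra.Algebra.Operations
import HarnessLib

/-!
# `(p,T)`-adic limits in `Λ = ℤ_p⟦T⟧` (coefficientwise), for Sprung's ♯/♭ construction

Support for the tree's discharge of `Sprung2017.thm112_exists_isSprungPair` (Sprung, Algebra Number
Theory 11 (2017), Thm. 1.12 via Cor. 4.4 [Sprung2017]): the Tandem vectors `Υ_n ∈ Λ²`
(`TandemRecursionProofs.lean`) have increments in `T·𝔪^{⌊n/2⌋}`, `𝔪 = (p, T)`, and their limit is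
the pair `(L♯, L♭)`. Sprung passes to the limit inside `𝓛og_{α,β}` over `ℂ_p` ("Proposition (yeah)":
`𝔐 = 0`); here the limit is taken in the compact ring `ℤ_p⟦T⟧` with its product (coefficientwise)
topology (Mathlib `PowerSeries.WithPiTopology`), in the manner of Lang, *Cyclotomic Fields I–II*,
Ch. 5 §1 Thm. 1.1 (`Λ ≅ lim ℤ_p[T]/(h_n)` for `h_n ∈ 𝔪^{n}`).

* `maxIdeal p = (C p, T) ⊂ ℤ_p⟦T⟧`; `mem_maxIdeal_of_dvd_constantCoeff`;
* `dvd_coeff_of_mem_pow` — `z ∈ 𝔪^c ⇒ p^{c−j} ∣ (coefficient j of z)`;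
* `exists_tendsto_of_sub_mem_pow` — a sequence with `y_{K+1} − y_K ∈ 𝔪^{c_K}`, `c_K → ∞`,
  converges coefficientwise (completeness of `ℤ_p`);
* `dvd_of_tendsto` — principal ideals `ω·Λ` are closed (compactness of `ℤ_p⟦T⟧`, Tychonoff), so a
  coefficientwise limit of multiples of `ω` is a multiple of `ω`.
[cite: Sprung2017, §4 "Proposition (yeah)" and the proof of Thm. 1.12] [cite: Lang1990, Ch. 5 §1 Thm. 1.1]

Cell `b2b-bsdres`, X8 prover B (gen 3). Pure commutative algebra / topology; nothing about curves.
-/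

set_option autoImplicit false

noncomputable section

open scoped PowerSeries.WithPiTopology Topology
open Filter PowerSeries

namespace Literature.NumberTheory.EllipticCurves.Sprung2017.MAdic

variable (p : ℕ) [Fact p.Prime]

/-- The maximal ideal `𝔪 = (p, T)` of `Λ = ℤ_p⟦T⟧`, as the span of `C p` and `T`.
[cite: Lang1990, Ch. 5 §1] -/
def maxIdeal : Ideal (PowerSeries ℤ_[p]) :=
  Ideal.span {PowerSeries.C (p : ℤ_[p]), PowerSeries.X}

/-- `C p ∈ 𝔪`. [cite: Lang1990, Ch. 5 §1] -/
theorem C_mem_maxIdeal : PowerSeries.C (p : ℤ_[p]) ∈ maxIdeal p :=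
  Ideal.subset_span (by simp)

/-- `T ∈ 𝔪`. [cite: Lang1990, Ch. 5 §1] -/
theorem X_mem_maxIdeal : (PowerSeries.X : PowerSeries ℤ_[p]) ∈ maxIdeal p :=
  Ideal.subset_span (by simp)

/-- A power series whose constant coefficient is divisible by `p` lies in `𝔪 = (p, T)`:
`g = C(g(0)) + T·(shift g)`. [cite: Lang1990, Ch. 5 §1] -/
theorem mem_maxIdeal_of_dvd_constantCoeff {g : PowerSeries ℤ_[p]}
    (h : (p : ℤ_[p]) ∣ PowerSeries.constantCoeff g) : g ∈ maxIdeal p := by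
  obtain ⟨c, hc⟩ := h
  have hg : g = PowerSeries.C (p : ℤ_[p]) * PowerSeries.C c +
      (PowerSeries.mk fun i ↦ PowerSeries.coeff (i + 1) g) * PowerSeries.X := by
    have h1 := PowerSeries.eq_shift_mul_X_add_const g
    rw [hc, map_mul] at h1
    exact h1.trans (add_comm _ _)
  rw [hg]
  exact Ideal.add_mem _ (Ideal.mul_mem_right _ _ (C_mem_maxIdeal p))
    (Ideal.mul_mem_left _ _ (X_mem_maxIdeal p))

/-! ### Coefficients of elements of `𝔪^c` -/

/-- The coefficient estimate is stable under multiplication by any power series: if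
`p^{c−j} ∣ z_j` for all `j` then `p^{c−j} ∣ (r·z)_j` for all `j`. [cite: Lang1990, Ch. 5 §1 Thm. 1.1 (proof)] -/
theorem dvd_coeff_mul_of_dvd_coeff {c : ℕ} {z : PowerSeries ℤ_[p]}
    (hz : ∀ j, (p : ℤ_[p]) ^ (c - j) ∣ PowerSeries.coeff j z) (r : PowerSeries ℤ_[p]) (j : ℕ) :
    (p : ℤ_[p]) ^ (c - j) ∣ PowerSeries.coeff j (r * z) := by
  rw [PowerSeries.coeff_mul]
  refine Finset.dvd_sum fun ij hij ↦ ?_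
  have hle : ij.2 ≤ j := by
    have := Finset.HasAntidiagonal.mem_antidiagonal.mp hij
    omega
  exact (pow_dvd_pow _ (by omega)).trans ((hz ij.2).mul_left _)

/-- **`z ∈ 𝔪^c ⇒ p^{c−j} ∣ z_j`** (the `j`-th coefficient of an element of `(p,T)^c` is divisible
by `p^{c−j}`): `𝔪^c` is spanned by `p^i T^{c−i}`, and `T^{c−i}` shifts coefficients by `c − i`.
Proved by induction along `𝔪^{c+1} = 𝔪·𝔪^c` (`Submodule.pow_induction_on_left'`).
[cite: Lang1990, Ch. 5 §1 Thm. 1.1 (proof)] -/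
theorem dvd_coeff_of_mem_pow {c : ℕ} {z : PowerSeries ℤ_[p]} (hz : z ∈ maxIdeal p ^ c) (j : ℕ) :
    (p : ℤ_[p]) ^ (c - j) ∣ PowerSeries.coeff j z := by
  revert j
  refine Submodule.pow_induction_on_left' (M := maxIdeal p)
    (C := fun n x _ ↦ ∀ j, (p : ℤ_[p]) ^ (n - j) ∣ PowerSeries.coeff j x) ?_ ?_ ?_ hz
  · intro r j
    simp
  · intro x y i _ _ hx hy j
    rw [map_add]
    exact dvd_add (hx j) (hy j)
  · intro m hm i x _ hx j
    obtain ⟨a, b, rfl⟩ := Ideal.mem_span_pair.mp hm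
    rw [add_mul, map_add]
    refine dvd_add ?_ ?_
    · -- `a · C p · x`
      rw [mul_assoc]
      refine dvd_coeff_mul_of_dvd_coeff p (c := i + 1) (fun k ↦ ?_) a j
      rw [PowerSeries.coeff_C_mul]
      exact (pow_dvd_pow _ (by omega)).trans
        ((pow_succ' (p : ℤ_[p]) (i - k)).symm ▸ mul_dvd_mul_left _ (hx k))
    · -- `b · T · x`
      rw [mul_assoc]
      refine dvd_coeff_mul_of_dvd_coeff p (c := i + 1) (fun k ↦ ?_) b j
      cases k with
      | zero => simp [PowerSeries.coeff_zero_X_mul]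
      | succ k =>
        rw [PowerSeries.coeff_succ_X_mul, show i + 1 - (k + 1) = i - k from by omega]
        exact hx k

/-! ### Coefficientwise limits -/

/-- **Completeness along `𝔪`-adic increments.** If `y : ℕ → ℤ_p⟦T⟧` has `y_{K+1} − y_K ∈ 𝔪^{c_K}`
with `c_K → ∞`, then `y` converges in the product topology of `ℤ_p⟦T⟧` (each coefficient sequence
is Cauchy in the complete ring `ℤ_p`). [cite: Lang1990, Ch. 5 §1 Thm. 1.1] -/
theorem exists_tendsto_of_sub_mem_pow (y : ℕ → PowerSeries ℤ_[p]) (c : ℕ → ℕ)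
    (hc : Tendsto c atTop atTop) (hy : ∀ K, y (K + 1) - y K ∈ maxIdeal p ^ c K) :
    ∃ L : PowerSeries ℤ_[p], Tendsto y atTop (𝓝 L) := by
  have hpP : (p : ℕ).Prime := Fact.out
  -- each coefficient sequence is Cauchy
  have hcoeff : ∀ j, ∃ l : ℤ_[p], Tendsto (fun K ↦ PowerSeries.coeff j (y K)) atTop (𝓝 l) := by
    intro j
    -- telescoping divisibility: beyond `N`, all increments of coefficient `j` are divisible by `p^m`
    have htel : ∀ m N, (∀ K, N ≤ K → m + j ≤ c K) →
        ∀ n, N ≤ n → (p : ℤ_[p]) ^ m ∣ PowerSeries.coeff j (y n) - PowerSeries.coeff j (y N) := by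
      intro m N hN n hn
      induction n with
      | zero =>
        have h0 : N = 0 := by omega
        subst h0
        simp
      | succ n ih =>
        rcases Nat.lt_or_ge n N with hlt | hge
        · have h1 : N = n + 1 := by omega
          subst h1
          simp
        · have hstep : (p : ℤ_[p]) ^ m ∣ PowerSeries.coeff j (y (n + 1)) - PowerSeries.coeff j (y n) := by
            rw [← map_sub]
            exact (pow_dvd_pow _ (by have := hN n hge; omega)).trans
              (dvd_coeff_of_mem_pow p (hy n) j)
          have := dvd_add hstep (ih hge)
          rwa [sub_add_sub_cancel] at this
    apply cauchySeq_tendsto_of_complete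
    refine Metric.cauchySeq_iff'.mpr fun ε hε ↦ ?_
    -- choose `m` with `p^{-m} < ε`, then `N` with `c_K ≥ m + j` beyond `N`
    obtain ⟨m, hm⟩ : ∃ m : ℕ, ((p : ℝ)⁻¹) ^ m < ε :=
      exists_pow_lt_of_lt_one hε (inv_lt_one_of_one_lt₀ (by exact_mod_cast hpP.one_lt))
    obtain ⟨N, hN⟩ := (hc.eventually_ge_atTop (m + j)).exists_forall_of_atTop
    refine ⟨N, fun n hn ↦ ?_⟩
    have hdvd := htel m N (fun K hK ↦ hN K hK) n hn
    rw [dist_eq_norm]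
    have hle : ‖PowerSeries.coeff j (y n) - PowerSeries.coeff j (y N)‖ ≤ (p : ℝ) ^ (-(m : ℤ)) :=
      (PadicInt.norm_le_pow_iff_mem_span_pow _ m).mpr (Ideal.mem_span_singleton.mpr hdvd)
    calc ‖PowerSeries.coeff j (y n) - PowerSeries.coeff j (y N)‖ ≤ (p : ℝ) ^ (-(m : ℤ)) := hle
      _ = ((p : ℝ)⁻¹) ^ m := by rw [zpow_neg, zpow_natCast, inv_pow]
      _ < ε := hm
  choose l hl using hcoeff
  refine ⟨PowerSeries.mk l, ?_⟩
  rw [PowerSeries.WithPiTopology.tendsto_iff_coeff_tendsto]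
  intro j
  simpa only [PowerSeries.coeff_mk] using hl j

/-- `ℤ_p⟦T⟧` is compact in the product topology (Tychonoff). [cite: Lang1990, Ch. 5 §1 Thm. 1.1] -/
private theorem compactSpace : CompactSpace (PowerSeries ℤ_[p]) :=
  inferInstanceAs (CompactSpace ((Unit →₀ ℕ) → ℤ_[p]))

/-- **Principal ideals are closed**: if `s_K → l` coefficientwise and `ω ∣ s_K` for every `K`, then
`ω ∣ l` (the image of the compact space `ℤ_p⟦T⟧` under `q ↦ ω·q` is compact, hence closed).
[cite: Lang1990, Ch. 5 §1 Thm. 1.1] -/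
theorem dvd_of_tendsto {ω l : PowerSeries ℤ_[p]} {s : ℕ → PowerSeries ℤ_[p]}
    (hs : Tendsto s atTop (𝓝 l)) (h : ∀ K, ω ∣ s K) : ω ∣ l := by
  haveI := compactSpace p
  have hcont : Continuous fun q : PowerSeries ℤ_[p] ↦ ω * q := continuous_const.mul continuous_id
  have hclosed : IsClosed (Set.range fun q : PowerSeries ℤ_[p] ↦ ω * q) :=
    (isCompact_range hcont).isClosed
  have hmem : l ∈ Set.range fun q : PowerSeries ℤ_[p] ↦ ω * q :=
    hclosed.mem_of_tendsto hs (Eventually.of_forall fun K ↦ by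
      obtain ⟨q, hq⟩ := h K
      exact ⟨q, hq.symm⟩)
  obtain ⟨q, hq⟩ := hmem
  exact ⟨q, hq.symm⟩

end Literature.NumberTheory.EllipticCurves.Sprung2017.MAdic

end
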